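import Summits.QuantumFields.BalabanUV.Beta.SymCorrectorSlot
import Literature.MathematicalPhysics.QuantumFieldTheory.Balaban1983to89.Beta.BalabanCompositeJets

/-!
# `BalabanUV.Beta.SymCorrectorSockets` — binder row D1, road «BF-x» junction (J1), the `Δ_n` Ward program (an2 R-D1-g43-3 (2)), brick TT5: **THE [S] SOCKETS OF THE FACE-TRANSPORTED
# FAMILIES** — the first-order transported family `slotPsiS r n S` of a local stencil family is a local stencil family, and the doubly transported pair family
# `α x ↦ slotPsiS r n (slotPsiS r n S₂ α x)` of a local fine bi-stencil family (`BalabanCompositeJets.LocStencil₂`) is one again — SAME rates, EXPLICIT constants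
# (`faceWtSum`, `(d+1)·2n^{d+1}`, `e^{cδ(d+1)n}`): the road's displayed structural sockets `hS ∕ hS₂` for the contact families `S^face`, `W₂^face` of `J1-DEFECT-WORDS` §5 (R-c1).
# They price NO [M] row and say nothing about the [M] CURRENCY (OWNER F-g22-2: the Wilson unit `(Lc^k)⁴` rides through every face family exactly as through the raw tables).
# RATE REMARK (gan24-leaf-05 g58 W-4, adopted): the sockets keep the slot-centred rate `δ` of the INPUT family through a block-wide face sum (spread `≤ (d+1)·n`), whence
# the factors `e^{cδ(d+1)n}` — harmless for QUALITATIVE uses (summability, the adjunction identities of TT3b∕TT4); a consumer that reads the constant QUANTITATIVELY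
# should take the input socket at a rate `∝ 1∕n` (`LocStencil` is monotone in the rate), so that the spread costs `e^{O(1)}`, as the road's (M-b) rows do.

HONEST FRAMING (cell contract, verbatim): «discharging `BetaPertH` makes Bałaban's UV stability UNCONDITIONAL — a real constructive-QFT result; it
is NOT the continuum limit and NOT the Clay problem.»  HONEST DEPENDENCY (verbatim): «continuum YM on T⁴ ⇐ BetaPertH ∧ nine spine estimates (0/9
proved); BetaPertH ⇐ (D1) ∧ (D4) ∧ CAP+tail; G-an2-4 gates asym, D1 and NE2/3/4.»
ABSOLUTE RULE (cell, verbatim): «No internally-minted statement may enter as a cited fact. Every hypothesis is either kernel-proved in this package or a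
verbatim quotation of a PUBLISHED theorem with page reference. The manuscript(s) under audit are NOT citable for their own disputed steps — they are the
thing under adjudication; programme-internal (2001/route/tribunal) claims are never citable.»  NOTHING is cited; no `def`, no `Prop` fact, 0 sorry; [folklore] finite-sum estimates
over the cell's OWN typed objects BY NAME.  Discharges NOTHING of (K), of hW ∕ hR ∕ D1Tel ∕ D1Rep (0∕4), of D1 or of BetaPertH; NOT continuum, NOT Clay.

CONTENT ([folklore]; `d+1` the lattice dimension, `0 < n`, root offset `r`):
§1 `abs_stencil_le_exp` (re-centring a stencil entry), **`locStencil_slotPsiS`** (`LocStencil S Cs δ → LocStencil (slotPsiS r n S) (Cs·(1 + faceWtSum·(d+1)·2n^{d+1}·e^{2δ(d+1)n})) δ`).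
§2 `locStencil₂_slotPsiS_outer`, `locStencil₂_slotPsiS_inner`, **`locStencil₂_slotPsiS₂`** (`LocStencil₂ S₂ C₂ δ → LocStencil₂ (α x ↦ slotPsiS r n (slotPsiS r n S₂ α x)) (C₂·(1+F e^{3δ(d+1)n})(1+F e^{δ(d+1)n})) δ`).
Provenance: D1 formalisation swarm, unit `b2b-balaban-beta-d1-formalise-leaf-03` (gen 29), 2026-08-23; over TT3a∕TT3b BY NAME; no existing file touched.
-/

namespace Summit.QuantumFields.BalabanUV.Beta.SymCorrectorSockets

open Finset
open scoped BigOperators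
open Literature.MathematicalPhysics.QuantumFieldTheory
open Literature.MathematicalPhysics.QuantumFieldTheory.Balaban1983to89
open Literature.MathematicalPhysics.QuantumFieldTheory.Balaban1983to89.Beta
open B12Sec2to5 (l1 l1_nonneg)
open ExpKernelCalculus (MKer BiLoc l1_sub_triangle l1_sub_symm)
open OneStepResolventKernel (Fib LocStencil)
open BalabanCompositeJets (LocStencil₂)
open AffineAveraging (Site Form1 box)
open AveragingContours (blk)
open Summit.QuantumFields.BalabanUV.Beta.KernelWardRelative (gaugeWt)
open Summit.QuantumFields.BalabanUV.Beta.SymCorrectorFace (faceWt faceWtSum faceWtSum_nonneg abs_faceWt_le gaugeWt_eq bondNbhd card_bondNbhd_le l1_le_of_mem_bondNbhd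
  faceSum slotPsiS slotPsiS_apply slotPsiS_apply_kernel)

noncomputable section

variable {d : ℕ}

/-! ## §1 The first-order transported family is a local stencil family -/

section Stencil

variable {S : Fin (d + 1) → Site (d + 1) → MKer (d + 1) (Fib d)} {Cs δs : ℝ}

/-- [folklore] **RE-CENTRING A STENCIL ENTRY** from `u` to `x`: `|S κ u p q a b| ≤ Cs·e^{2δ|u−x|₁}·e^{−δ(|p−x|₁+|q−x|₁)}` (triangle inequality; `0 ≤ δ`). -/
theorem abs_stencil_le_exp (hS : LocStencil S Cs δs) (hδs : 0 ≤ δs) (κ : Fin (d + 1)) (u x p q : Site (d + 1)) (a b : Fib d) :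
    |S κ u p q a b| ≤ Cs * Real.exp (δs * (2 * l1 (u - x))) * Real.exp (-δs * (l1 (p - x) + l1 (q - x))) := by
  have hCs : 0 ≤ Cs := (hS κ u).nonneg (Sum.inl 0)
  have tp : l1 (p - x) ≤ l1 (p - u) + l1 (u - x) := l1_sub_triangle p u x
  have tq : l1 (q - x) ≤ l1 (q - u) + l1 (u - x) := l1_sub_triangle q u x
  calc |S κ u p q a b| ≤ Cs * Real.exp (-δs * (l1 (p - u) + l1 (q - u))) := hS κ u p q a b
    _ ≤ Cs * (Real.exp (δs * (2 * l1 (u - x))) * Real.exp (-δs * (l1 (p - x) + l1 (q - x)))) := by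
        refine mul_le_mul_of_nonneg_left ?_ hCs
        rw [← Real.exp_add]
        exact Real.exp_le_exp.2 (by nlinarith)
    _ = _ := by ring

variable {n : ℕ} (hn : 0 < n) (r : Fin (d + 1) → ℕ)
include hn

/-- [folklore] **THE TRANSPORTED FAMILY IS A LOCAL STENCIL FAMILY**: `LocStencil S Cs δ ⟹ LocStencil (slotPsiS r n S) (Cs·(1 + faceWtSum·(d+1)·2n^{d+1}·e^{2δ(d+1)n})) δ`
— the face sum has `≤ (d+1)·2n^{d+1}` terms, each a table localised within `(d+1)n` of the slot, weighted by `|gaugeWt| ≤ 1` and `|faceWt| ≤ faceWtSum`. -/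
theorem locStencil_slotPsiS (hS : LocStencil S Cs δs) (hδs : 0 ≤ δs) :
    LocStencil (slotPsiS r n S)
      (Cs * (1 + faceWtSum r n * (((d + 1 : ℕ) : ℝ) * (2 * (n : ℝ) ^ (d + 1))) * Real.exp (δs * (2 * (((d + 1 : ℕ) : ℝ) * n))))) δs := by
  classical
  intro α x p q a b
  have hCs : 0 ≤ Cs := (hS α x).nonneg (Sum.inl 0)
  set E : ℝ := Real.exp (-δs * (l1 (p - x) + l1 (q - x))) with hE
  set M : ℝ := Real.exp (δs * (2 * (((d + 1 : ℕ) : ℝ) * n))) with hM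
  have hE0 : 0 ≤ E := (Real.exp_pos _).le
  -- each face term
  have hterm : ∀ κ' : Fin (d + 1), ∀ u ∈ bondNbhd n (blk n x) κ', |gaugeWt n (blk n x) κ' u * S κ' u p q a b| ≤ Cs * M * E := by
    intro κ' u hu
    rw [abs_mul]
    have hg : |gaugeWt n (blk n x) κ' u| ≤ 1 := by
      rw [gaugeWt_eq]; split_ifs <;> norm_num
    have hs : |S κ' u p q a b| ≤ Cs * M * E := by
      refine (abs_stencil_le_exp hS hδs κ' u x p q a b).trans ?_
      refine mul_le_mul_of_nonneg_right (mul_le_mul_of_nonneg_left (Real.exp_le_exp.2 ?_) hCs) hE0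
      have := l1_le_of_mem_bondNbhd hn hu
      nlinarith
    calc |gaugeWt n (blk n x) κ' u| * |S κ' u p q a b| ≤ 1 * (Cs * M * E) := mul_le_mul hg hs (abs_nonneg _) zero_le_one
      _ = Cs * M * E := one_mul _
  -- the face sum
  have hface : |(∑ κ' : Fin (d + 1), ∑ u ∈ bondNbhd n (blk n x) κ', gaugeWt n (blk n x) κ' u • S κ' u) p q a b|
      ≤ ((d + 1 : ℕ) : ℝ) * (2 * (n : ℝ) ^ (d + 1)) * (Cs * M * E) := by
    rw [Finset.sum_apply, Finset.sum_apply, Finset.sum_apply, Finset.sum_apply]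
    refine (Finset.abs_sum_le_sum_abs _ _).trans ?_
    have hin : ∀ κ' : Fin (d + 1), |(∑ u ∈ bondNbhd n (blk n x) κ', gaugeWt n (blk n x) κ' u • S κ' u) p q a b| ≤ (2 * (n : ℝ) ^ (d + 1)) * (Cs * M * E) := by
      intro κ'
      rw [Finset.sum_apply, Finset.sum_apply, Finset.sum_apply, Finset.sum_apply]
      refine (Finset.abs_sum_le_sum_abs _ _).trans ?_
      calc ∑ u ∈ bondNbhd n (blk n x) κ', |(gaugeWt n (blk n x) κ' u • S κ' u) p q a b|
          ≤ ∑ _u ∈ bondNbhd n (blk n x) κ', Cs * M * E := Finset.sum_le_sum fun u hu => by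
              simp only [Pi.smul_apply, smul_eq_mul]; exact hterm κ' u hu
        _ = (bondNbhd n (blk n x) κ').card * (Cs * M * E) := by rw [Finset.sum_const, nsmul_eq_mul]
        _ ≤ (2 * (n : ℝ) ^ (d + 1)) * (Cs * M * E) := mul_le_mul_of_nonneg_right (card_bondNbhd_le n _ κ') (by positivity)
    calc ∑ κ' : Fin (d + 1), |(∑ u ∈ bondNbhd n (blk n x) κ', gaugeWt n (blk n x) κ' u • S κ' u) p q a b|
        ≤ ∑ _κ' : Fin (d + 1), (2 * (n : ℝ) ^ (d + 1)) * (Cs * M * E) := Finset.sum_le_sum fun κ' _ => hin κ'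
      _ = ((d + 1 : ℕ) : ℝ) * (2 * (n : ℝ) ^ (d + 1)) * (Cs * M * E) := by
          rw [Finset.sum_const, Finset.card_univ, Fintype.card_fin, nsmul_eq_mul]; ring
  -- assemble
  rw [slotPsiS_apply, Pi.add_apply, Pi.add_apply, Pi.add_apply, Pi.add_apply, Pi.smul_apply, Pi.smul_apply, Pi.smul_apply, Pi.smul_apply, smul_eq_mul]
  refine (abs_add_le _ _).trans ?_
  rw [abs_mul]
  have h1 : |S α x p q a b| ≤ Cs * E := hS α x p q a b
  have h2 : |faceWt r n α x| * |(∑ κ' : Fin (d + 1), ∑ u ∈ bondNbhd n (blk n x) κ', gaugeWt n (blk n x) κ' u • S κ' u) p q a b|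
      ≤ faceWtSum r n * (((d + 1 : ℕ) : ℝ) * (2 * (n : ℝ) ^ (d + 1)) * (Cs * M * E)) :=
    mul_le_mul (abs_faceWt_le hn r α x) hface (abs_nonneg _) (faceWtSum_nonneg r n)
  calc |S α x p q a b| + |faceWt r n α x| * |(∑ κ' : Fin (d + 1), ∑ u ∈ bondNbhd n (blk n x) κ', gaugeWt n (blk n x) κ' u • S κ' u) p q a b|
      ≤ Cs * E + faceWtSum r n * (((d + 1 : ℕ) : ℝ) * (2 * (n : ℝ) ^ (d + 1)) * (Cs * M * E)) := add_le_add h1 h2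
    _ = Cs * (1 + faceWtSum r n * (((d + 1 : ℕ) : ℝ) * (2 * (n : ℝ) ^ (d + 1))) * M) * E := by ring

end Stencil

/-! ## §2 The doubly transported pair family is a local fine bi-stencil family -/

section PairStencil

variable {n : ℕ} (hn : 0 < n) (r : Fin (d + 1) → ℕ)
  {S₂ : Fin (d + 1) → Site (d + 1) → Fin (d + 1) → Site (d + 1) → MKer (d + 1) (Fib d)} {C₂ δ₂ : ℝ}
include hn

/-- [folklore] **OUTER TRANSPORT KEEPS `LocStencil₂`**: `LocStencil₂ S₂ C₂ δ ⟹ LocStencil₂ (slotPsiS r n S₂) (C₂·(1 + faceWtSum·(d+1)·2n^{d+1}·e^{3δ(d+1)n})) δ`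
(the face members `S₂ κ u` of the block of `x` are re-centred from `u` to `x`, `|u − x|₁ ≤ (d+1)n`, in the three exponentials). -/
theorem locStencil₂_slotPsiS_outer (hS₂ : LocStencil₂ S₂ C₂ δ₂) (hδ₂ : 0 ≤ δ₂) :
    LocStencil₂ (slotPsiS r n S₂) (C₂ * (1 + faceWtSum r n * (((d + 1 : ℕ) : ℝ) * (2 * (n : ℝ) ^ (d + 1))) * Real.exp (δ₂ * (3 * (((d + 1 : ℕ) : ℝ) * n))))) δ₂ := by
  classical
  intro α x κ' u' p q a b
  have hC₂ : 0 ≤ C₂ := hS₂.nonneg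
  set E : ℝ := Real.exp (-δ₂ * l1 (u' - x)) * Real.exp (-δ₂ * (l1 (p - x) + l1 (q - x))) with hE
  set M : ℝ := Real.exp (δ₂ * (3 * (((d + 1 : ℕ) : ℝ) * n))) with hM
  have hE0 : 0 ≤ E := by positivity
  -- a face member re-centred at `x`
  have hmem : ∀ κ : Fin (d + 1), ∀ u ∈ bondNbhd n (blk n x) κ, |S₂ κ u κ' u' p q a b| ≤ C₂ * M * E := by
    intro κ u hu
    have hl := l1_le_of_mem_bondNbhd hn hu
    have t1 : l1 (u' - x) ≤ l1 (u' - u) + l1 (u - x) := l1_sub_triangle u' u x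
    have t2 : l1 (p - x) ≤ l1 (p - u) + l1 (u - x) := l1_sub_triangle p u x
    have t3 : l1 (q - x) ≤ l1 (q - u) + l1 (u - x) := l1_sub_triangle q u x
    refine (hS₂ κ u κ' u' p q a b).trans ?_
    rw [hE, hM, mul_assoc, mul_assoc, ← Real.exp_add, ← Real.exp_add, ← Real.exp_add]
    exact mul_le_mul_of_nonneg_left (Real.exp_le_exp.2 (by nlinarith)) hC₂
  -- the face sum
  have hface : |(∑ κ : Fin (d + 1), ∑ u ∈ bondNbhd n (blk n x) κ, gaugeWt n (blk n x) κ u • S₂ κ u) κ' u' p q a b|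
      ≤ ((d + 1 : ℕ) : ℝ) * (2 * (n : ℝ) ^ (d + 1)) * (C₂ * M * E) := by
    simp only [Finset.sum_apply, Pi.smul_apply, smul_eq_mul]
    refine (Finset.abs_sum_le_sum_abs _ _).trans ?_
    have hin : ∀ κ : Fin (d + 1), |∑ u ∈ bondNbhd n (blk n x) κ, gaugeWt n (blk n x) κ u * S₂ κ u κ' u' p q a b| ≤ (2 * (n : ℝ) ^ (d + 1)) * (C₂ * M * E) := by
      intro κ
      refine (Finset.abs_sum_le_sum_abs _ _).trans ?_
      calc ∑ u ∈ bondNbhd n (blk n x) κ, |gaugeWt n (blk n x) κ u * S₂ κ u κ' u' p q a b| ≤ ∑ _u ∈ bondNbhd n (blk n x) κ, C₂ * M * E :=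
            Finset.sum_le_sum fun u hu => by
              rw [abs_mul]
              have hg : |gaugeWt n (blk n x) κ u| ≤ 1 := by rw [gaugeWt_eq]; split_ifs <;> norm_num
              calc |gaugeWt n (blk n x) κ u| * |S₂ κ u κ' u' p q a b| ≤ 1 * (C₂ * M * E) := mul_le_mul hg (hmem κ u hu) (abs_nonneg _) zero_le_one
                _ = C₂ * M * E := one_mul _
        _ = (bondNbhd n (blk n x) κ).card * (C₂ * M * E) := by rw [Finset.sum_const, nsmul_eq_mul]
        _ ≤ (2 * (n : ℝ) ^ (d + 1)) * (C₂ * M * E) := mul_le_mul_of_nonneg_right (card_bondNbhd_le n _ κ) (by positivity)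
    calc ∑ κ : Fin (d + 1), |∑ u ∈ bondNbhd n (blk n x) κ, gaugeWt n (blk n x) κ u * S₂ κ u κ' u' p q a b| ≤ ∑ _κ : Fin (d + 1), (2 * (n : ℝ) ^ (d + 1)) * (C₂ * M * E) :=
          Finset.sum_le_sum fun κ _ => hin κ
      _ = ((d + 1 : ℕ) : ℝ) * (2 * (n : ℝ) ^ (d + 1)) * (C₂ * M * E) := by rw [Finset.sum_const, Finset.card_univ, Fintype.card_fin, nsmul_eq_mul]; ring
  -- the raw member at `x` itself: `M ≥ 1`
  have hM1 : 1 ≤ M := by rw [hM]; exact Real.one_le_exp (by positivity)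
  have h1 : |S₂ α x κ' u' p q a b| ≤ C₂ * E := by
    have h := hS₂ α x κ' u' p q a b; rwa [hE, ← mul_assoc]
  rw [slotPsiS_apply, Pi.add_apply, Pi.add_apply, Pi.add_apply, Pi.add_apply, Pi.add_apply, Pi.add_apply, Pi.smul_apply, Pi.smul_apply, Pi.smul_apply,
    Pi.smul_apply, Pi.smul_apply, Pi.smul_apply, smul_eq_mul]
  refine (abs_add_le _ _).trans ?_
  rw [abs_mul]
  have h2 := mul_le_mul (abs_faceWt_le hn r α x) hface (abs_nonneg _) (faceWtSum_nonneg r n)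
  calc |S₂ α x κ' u' p q a b| + |faceWt r n α x| * |(∑ κ : Fin (d + 1), ∑ u ∈ bondNbhd n (blk n x) κ, gaugeWt n (blk n x) κ u • S₂ κ u) κ' u' p q a b|
      ≤ C₂ * E + faceWtSum r n * (((d + 1 : ℕ) : ℝ) * (2 * (n : ℝ) ^ (d + 1)) * (C₂ * M * E)) := add_le_add h1 h2
    _ = C₂ * (1 + faceWtSum r n * (((d + 1 : ℕ) : ℝ) * (2 * (n : ℝ) ^ (d + 1))) * M) * E := by ring
    _ = C₂ * (1 + faceWtSum r n * (((d + 1 : ℕ) : ℝ) * (2 * (n : ℝ) ^ (d + 1))) * M) * Real.exp (-δ₂ * l1 (u' - x)) * Real.exp (-δ₂ * (l1 (p - x) + l1 (q - x))) := by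
        rw [hE]; ring

/-- [folklore] **INNER TRANSPORT KEEPS `LocStencil₂`**: transporting the SECOND bond of every slice, `LocStencil₂ G C δ ⟹ LocStencil₂ (α x ↦ slotPsiS r n (G α x)) (C·(1 + faceWtSum·(d+1)·2n^{d+1}·e^{δ(d+1)n})) δ`
(the second-bond face members `u″` of the block of `u′` are within `(d+1)n` of `u′`). -/
theorem locStencil₂_slotPsiS_inner {G : Fin (d + 1) → Site (d + 1) → Fin (d + 1) → Site (d + 1) → MKer (d + 1) (Fib d)} {C δ : ℝ} (hG : LocStencil₂ G C δ) (hδ : 0 ≤ δ) :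
    LocStencil₂ (fun α x => slotPsiS r n (G α x)) (C * (1 + faceWtSum r n * (((d + 1 : ℕ) : ℝ) * (2 * (n : ℝ) ^ (d + 1))) * Real.exp (δ * (((d + 1 : ℕ) : ℝ) * n)))) δ := by
  classical
  intro α x κ' u' p q a b
  have hC : 0 ≤ C := hG.nonneg
  set E : ℝ := Real.exp (-δ * (l1 (p - x) + l1 (q - x))) with hE
  set M : ℝ := Real.exp (δ * (((d + 1 : ℕ) : ℝ) * n)) with hM
  -- every second-bond member near `u'`, read at `(p,q)`: bounded by `C·M·e^{−δ|u′−x|}·E`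
  have hmem : ∀ κ'' : Fin (d + 1), ∀ u'' ∈ bondNbhd n (blk n u') κ'', |G α x κ'' u'' p q a b| ≤ C * M * Real.exp (-δ * l1 (u' - x)) * E := by
    intro κ'' u'' hu
    have hl := l1_le_of_mem_bondNbhd hn hu
    have t1 : l1 (u' - x) ≤ l1 (u' - u'') + l1 (u'' - x) := l1_sub_triangle u' u'' x
    rw [l1_sub_symm u' u''] at t1
    refine (hG α x κ'' u'' p q a b).trans ?_
    rw [hM, hE, mul_assoc, mul_assoc, mul_assoc, ← Real.exp_add, ← Real.exp_add, ← Real.exp_add]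
    exact mul_le_mul_of_nonneg_left (Real.exp_le_exp.2 (by nlinarith)) hC
  have e : slotPsiS r n (G α x) κ' u' p q a b = G α x κ' u' p q a b
      + faceWt r n κ' u' * ∑ κ'' : Fin (d + 1), ∑ u'' ∈ bondNbhd n (blk n u') κ'', gaugeWt n (blk n u') κ'' u'' * G α x κ'' u'' p q a b := by
    simp only [slotPsiS, SymCorrectorFace.faceSum, Pi.add_apply, Pi.smul_apply, Finset.sum_apply, smul_eq_mul]
  show |slotPsiS r n (G α x) κ' u' p q a b| ≤ _
  rw [e]
  have hface : |∑ κ'' : Fin (d + 1), ∑ u'' ∈ bondNbhd n (blk n u') κ'', gaugeWt n (blk n u') κ'' u'' * G α x κ'' u'' p q a b|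
      ≤ ((d + 1 : ℕ) : ℝ) * (2 * (n : ℝ) ^ (d + 1)) * (C * M * Real.exp (-δ * l1 (u' - x)) * E) := by
    refine (Finset.abs_sum_le_sum_abs _ _).trans ?_
    have hin : ∀ κ'' : Fin (d + 1), |∑ u'' ∈ bondNbhd n (blk n u') κ'', gaugeWt n (blk n u') κ'' u'' * G α x κ'' u'' p q a b|
        ≤ (2 * (n : ℝ) ^ (d + 1)) * (C * M * Real.exp (-δ * l1 (u' - x)) * E) := by
      intro κ''
      refine (Finset.abs_sum_le_sum_abs _ _).trans ?_
      calc ∑ u'' ∈ bondNbhd n (blk n u') κ'', |gaugeWt n (blk n u') κ'' u'' * G α x κ'' u'' p q a b|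
          ≤ ∑ _u'' ∈ bondNbhd n (blk n u') κ'', C * M * Real.exp (-δ * l1 (u' - x)) * E := Finset.sum_le_sum fun u'' hu => by
              rw [abs_mul]
              have hg : |gaugeWt n (blk n u') κ'' u''| ≤ 1 := by rw [gaugeWt_eq]; split_ifs <;> norm_num
              calc |gaugeWt n (blk n u') κ'' u''| * |G α x κ'' u'' p q a b| ≤ 1 * (C * M * Real.exp (-δ * l1 (u' - x)) * E) :=
                    mul_le_mul hg (hmem κ'' u'' hu) (abs_nonneg _) zero_le_one
                _ = _ := one_mul _
        _ = (bondNbhd n (blk n u') κ'').card * (C * M * Real.exp (-δ * l1 (u' - x)) * E) := by rw [Finset.sum_const, nsmul_eq_mul]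
        _ ≤ (2 * (n : ℝ) ^ (d + 1)) * (C * M * Real.exp (-δ * l1 (u' - x)) * E) := mul_le_mul_of_nonneg_right (card_bondNbhd_le n _ κ'') (by positivity)
    calc ∑ κ'' : Fin (d + 1), |∑ u'' ∈ bondNbhd n (blk n u') κ'', gaugeWt n (blk n u') κ'' u'' * G α x κ'' u'' p q a b|
        ≤ ∑ _κ'' : Fin (d + 1), (2 * (n : ℝ) ^ (d + 1)) * (C * M * Real.exp (-δ * l1 (u' - x)) * E) := Finset.sum_le_sum fun κ'' _ => hin κ''
      _ = ((d + 1 : ℕ) : ℝ) * (2 * (n : ℝ) ^ (d + 1)) * (C * M * Real.exp (-δ * l1 (u' - x)) * E) := by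
          rw [Finset.sum_const, Finset.card_univ, Fintype.card_fin, nsmul_eq_mul]; ring
  have hM1 : 1 ≤ M := by rw [hM]; exact Real.one_le_exp (by positivity)
  have h1 : |G α x κ' u' p q a b| ≤ C * Real.exp (-δ * l1 (u' - x)) * E := by have h := hG α x κ' u' p q a b; rwa [hE]
  refine (abs_add_le _ _).trans ?_
  rw [abs_mul]
  have h2 := mul_le_mul (abs_faceWt_le hn r κ' u') hface (abs_nonneg _) (faceWtSum_nonneg r n)
  calc |G α x κ' u' p q a b| + |faceWt r n κ' u'| * |∑ κ'' : Fin (d + 1), ∑ u'' ∈ bondNbhd n (blk n u') κ'', gaugeWt n (blk n u') κ'' u'' * G α x κ'' u'' p q a b|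
      ≤ C * Real.exp (-δ * l1 (u' - x)) * E + faceWtSum r n * (((d + 1 : ℕ) : ℝ) * (2 * (n : ℝ) ^ (d + 1)) * (C * M * Real.exp (-δ * l1 (u' - x)) * E)) := add_le_add h1 h2
    _ = C * (1 + faceWtSum r n * (((d + 1 : ℕ) : ℝ) * (2 * (n : ℝ) ^ (d + 1))) * M) * Real.exp (-δ * l1 (u' - x)) * E := by ring

/-- [folklore] **BOTH TRANSPORTS KEEP `LocStencil₂`** (the [S] socket of the pair contact family `W₂^c`'s table in the road's shape): for `LocStencil₂ S₂ C₂ δ`,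
`LocStencil₂ (α x ↦ slotPsiS r n (slotPsiS r n S₂ α x)) (C₂·(1 + F·e^{3δ(d+1)n})·(1 + F·e^{δ(d+1)n})) δ` with `F := faceWtSum·(d+1)·2n^{d+1}`. -/
theorem locStencil₂_slotPsiS₂ (hS₂ : LocStencil₂ S₂ C₂ δ₂) (hδ₂ : 0 ≤ δ₂) :
    LocStencil₂ (fun α x => slotPsiS r n (slotPsiS r n S₂ α x))
      (C₂ * (1 + faceWtSum r n * (((d + 1 : ℕ) : ℝ) * (2 * (n : ℝ) ^ (d + 1))) * Real.exp (δ₂ * (3 * (((d + 1 : ℕ) : ℝ) * n))))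
        * (1 + faceWtSum r n * (((d + 1 : ℕ) : ℝ) * (2 * (n : ℝ) ^ (d + 1))) * Real.exp (δ₂ * (((d + 1 : ℕ) : ℝ) * n)))) δ₂ :=
  locStencil₂_slotPsiS_inner hn r (locStencil₂_slotPsiS_outer hn r hS₂ hδ₂) hδ₂

end PairStencil

end

end Summit.QuantumFields.BalabanUV.Beta.SymCorrectorSockets
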